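import Mathlib
import HarnessLib
import HarnessLib.Audit
import Summits.KontsevichZagierPeriods.Statement
import HarnessLib.Audit.Status.Attr

/-!
Route: SpheresForWalls

# Route SpheresForWalls — walls are π-torsion — Archimedes' hat-box un-reduces every wall; κⁿ·r is
an analytic density on (S²)ⁿ, where Conjecture 1[1/π] is Kontsevich's formal period conjecture for
CLOSED real periods

It suffices to show X = SpinNormalForm ∧ SphericalKernel ∧ PiCancellation. Write κ = [π]⋆ for the
DISC PADDING r ↦ [{z₀² + z₁² ≤ 1} × σ, f ∘ tail²] : IntegralRep n → IntegralRep (n+2), stated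
import-free in the pinned P-form of AyoubSpecialisation 0540/0541 and KatzTower rev 1 (∀ P : ∀ n,
IntegralRep n → IntegralRep (n+2) pinned by that
domain and integrand; on FormalRep κ = FreeAbelianGroup.lift (of ∘ P); P exists, is unique, and
multiplies values by π — construction and value law
are PROVED inside `closes`, rev 1 cone repair), and call a representation SPHERICAL
if its domain is all of ℝ^{2m} and its density is real-analytic on the product of spheres (S²)^m —
i.e. analytic at every point of ℝ^{2m}
and, after inverting any sub-family of the m coordinate planes (w_k ↦ w_k/|w_k|², Jacobian |w_k|⁻⁴),
again analytic: an integral of an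
analytic (Nash) density over a CLOSED real-algebraic manifold, no wall anywhere. (SpinNormalForm,
the engine) for every integral representation
r of dimension n there is N₀ such that κ^N·[r] is KZ-equivalent to ONE spherical representation for
every N ≥ N₀ — ARCHIMEDES' HAT-BOX
THEOREM read as a move: shear each wall of each cell to height 0, uniformise the Puiseux exponents,
and replace the height interval by a
2-sphere through the area-preserving cylinder↔sphere map composed with stereographic projection,
(z,t) ↦ w with z = (|w|²−1)/(|w|²+1),
dz·dt/(1+t²) = 2d²w/(1+|w|²)²; both walls become the two poles and disappear, one factor κ per
coordinate (Delzant/Lerman symplectic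
un-reduction: the wall is the moment image of a circle of fixed points). (SphericalKernel, the core)
every vanishing ℤ-combination of
spherical representations has a κ-power multiple in KZ.relations. (PiCancellation, shared with
AyoubSpecialisation / KatzTower / SpectatorSlicing)
κ·c ∈ relations ⇒ c ∈ relations. SpinNormalForm ∧ SphericalKernel is exactly the π-local kernel form
(AyoubSpecialisation's crux 0541,
`KZ.PiLocalKernel`) RELOCATED onto closed periods; with PiCancellation it is the kernel form, hence
the summit (deciding theorem `closes`,
proved in the planner's Sketch.lean / glue.lean, rc 0). No idea card is realised (novel-route seat);
nearest cards are cited under Novelty.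
Lean: `SpinNormalForm ∧ SphericalKernel ∧ PiCancellation`

## Assembly
glue.lean, PROVED (rev 1: Mathlib + the Statement's own cone only, 0 sorries, axioms
propext/Classical.choice/Quot.sound): `closes` first
CONSTRUCTS the pinned disc padding P (ℚ-semialgebraicity by coordinate preimages, absolute
convergence by Tonelli — the AyoubSpecialisation
construction) and proves its VALUE LAW value(P r) = π·value(r) (Fubini along ℝⁿ⁺² ≃ᵐ (ℝ×ℝ)×ℝⁿ and
the disc area, Complex.volume_closedBall),
so κ = lift(of ∘ P) is additive and multiplies values by π. Given rational r, r′ with equal values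
put c = [r] − [r′], KZ.eval c = 0.
SpinNormalForm at the common exponent N = max(N₀(r), N₀(r′)) gives spherical R₁, R₂ with κ^N[r] ≡
[R₁], κ^N[r′] ≡ [R₂]; by soundness
(`KZ.relations_le_ker_eval_holds`) d = [R₁] − [R₂] is a vanishing combination in the spherical span;
SphericalKernel gives κ^{N′} d ∈ relations and
PiCancellation peels it to d ∈ relations; then κ^N c = (κ^N c − d) + d ∈ relations and
PiCancellation peels again: c ∈ relations, i.e.
KZ.Equivalent r r′ (no ideal property of relations under κ is needed). RationalSphereLayer is
carried as a hypothesis of `closes` (crux-only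
deciding theorem) and cleared.

Rationale: WHY THIS LINE. BEHIND THE WALLS THE CALCULUS IS ALGEBRAIC DE RHAM. On spherical representations the
two relators of Kontsevich's formal period algebra are
visibly moves and the third does not exist: (i) EXACTNESS — a spherical density is a top form on the
smooth AFFINE variety
U = (ℙ¹×ℙ¹)^m ∖ D (complexification of (S²)^m minus the polar divisor), so if its class vanishes it
is dη with η ALGEBRAIC
(Grothendieck's algebraic de Rham theorem, Grothendieck1966), and ∫ dη = 0 over the closed manifold
(S²)^m is, in the chart ℝ^{2m}, a sum
of improper Newton–Leibniz moves whose primitives are the rational/Nash coefficients of η (support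
WallFreeExactness, provable now) — NO
PRIMITIVE OF THE INTEGRAND IS EVER TAKEN, so the catalogued primitive barrier (Ayoub2015 Rem. 1.2,
Fresan2024 Rem. 3.6) is structurally
absent; (ii) FUNCTORIALITY — pullback along a finite Nash self-correspondence of (S²)^m of degree d
is a (multivalued) change of variables;
(iii) the BOUNDARY/connecting-morphism relator of HuberMullerStachPeriods2017 Def. 13.1.1 has
nothing to act on. Hence SphericalKernel is
Kontsevich's formal period conjecture (KontsevichZagier2001 §4.1; HuberMullerStachPeriods2017 Conj.
13.2.1; Hörmann arXiv:2106.03803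
Thm 1.2: injectivity ⇔ "every vanishing ⟨σ,ω⟩ comes from a short exact sequence of motives")
RESTRICTED to the closed real pairs
(U, [(S²)^m]) — GPC-strength, carried openly as the last-ranked crux — and the line's claim is that
NOTHING ELSE of Conjecture 1 survives
π-localisation: walls, corners, relative cohomology and transcendental primitives are all π-torsion.
Imported: Archimedes/Duistermaat–Heckman
(symplectic un-reduction; DuistermaatHeckman1982) as a NORMAL FORM rather than as a volume
computation; embedded resolution and Puiseux
uniformisation of cylindrical cells (Hironaka1964, BierstoneMilman1988, BochnakCosteRoy1998 §§2,8,9)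
inside the rules; Deligne's weights
(DeligneHodgeII1971) only as the consistency check that n twists are exactly what the weight-spread
criterion of the in-tree closed card
`problem-five-closed-periods-weight-spread` demands for an n-dimensional representation (weights in
[0,2n] shift to [2n,4n], w₂ ≤ 2w₁). What
prior routes do not do: AyoubSpecialisation localises at [π] algebraically and attacks 0541 through
Ayoub's relative periods; VeryGoodTransfer
resolves into bounded domains with C¹ integrands (walls stay) and still needs the boundary relator;
AttractorUnfolding uses the tube ([π]⋆ =
arctangent carrier) to MANUFACTURE 2πi for residues; the DH/Archimedes cards compile specific
volumes. Here the same classical map is run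
in the opposite direction on EVERY wall of EVERY representation, and the output is a provable
normal-form theorem plus a strictly smaller
relator set for the conjectural core.

RANKED CRUXES. #2 SpinNormalForm (crux) — HAT-BOX NORMAL FORM — for every integral representation r
of dimension n there is N₀ such that for every N ≥ N₀ the twisted class κ^N·[r] = (lift (of ∘
P))^[N] (KZ.of r) — for every pinned disc padding P n r = [{z₀²+z₁² ≤ 1} × σ, f ∘ tail²]
(import-free P-form, rev 1) — is KZ-equivalent to a single SPHERICAL representation R of some
dimension 2m: domain all of ℝ^{2m}, integrand analytic at every point, and analytic again after
inverting any sub-family of the m coordinate planes (the chart condition spelled out inline: for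
each ε : Fin m → Bool there is an everywhere-analytic K agreeing, off the inverted planes' origins,
with the pulled-back density R.integrand(inv_ε w)·∏_{ε k}|w_k|⁻⁴). Intended proof: CAD; embedded
resolution so the integrand is (unit)×(monomial with exponents > −1) at every corner of every cell;
power substitutions making the exponents non-negative integers and the cell-wall functions analytic
across the base walls; affine rescaling of each fibre interval to (−1,1); the
Archimedes–stereographic change of variables per coordinate (κ each, both walls ↦ the two poles);
integrand additivity merges the cells on the common domain ℝ^{2m}; extra κ's are absorbed by
TwistStable. [difficulty: L] (why it might fail: corner uniformisation must happen BEFORE spinning,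
walls still available; if some normal-crossings/Puiseux configuration of the CAD wall functions
resists, the output is analytic only off codimension 2 — and such densities can hide a boundary
(fake log 2 at ∞).) [KontsevichZagier2001, BochnakCosteRoy1998, Hironaka1964, BierstoneMilman1988,
DuistermaatHeckman1982]
#3 PiCancellation (crux) — [π] is a non-zero-divisor modulo the moves: lift (of ∘ P) c ∈
KZ.relations → c ∈ KZ.relations for every pinned disc padding P and every formal combination c —
since rev 1 LITERALLY AyoubSpecialisation's stmt-0540 (= KatzTower's PiCancellation;
SpectatorSlicing's target in product form; shared, staffed there; here it is the seam that turns the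
π-local conclusion into the summit). [difficulty: open-problem] (why it might fail: a true identity
reachable only through an auxiliary factor of π (effective period MONOID vs motivic GROUP,
AyoubRelKZRevisited Rem. 1.3; HMS §13.1 P^eff vs P^eff[(2πi)⁻¹]) would refute it and, with it, the
H21-literal summit (route Neg's bet).) [Ayoub2014, AyoubRelKZRevisited, HuberMullerStachPeriods2017]
#4 RationalSphereLayer (crux) — FIRST DECIDED LAYER of SphericalKernel — on the span of the
spherical representations of dimension 2 whose density is a quotient of ℚ-polynomials (one sphere,
poles along finitely many conics/curves disjoint from S²), every vanishing ℤ-combination has a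
κ-power multiple in KZ.relations. Such values are π × (1-periods of the polar curves: logarithms of
algebraic numbers, complete elliptic/abelian integrals, algebraic numbers; level ≤ 1 by the in-tree
HodgeLevel lemma), so Huber–Wüstholz (HuberWustholz2022 Thm 13.3: every ℚ̄-linear relation among
1-periods is generated by bilinearity, exactness and functoriality of 1-motives) DECIDES which
combinations vanish; the crux is that each generator is realised on the sphere by WallFreeExactness
(exactness), a sheeted change of variables of S² (functoriality) and the real structure
(orientation-reversing symmetry), up to κ-twists. It is the layer where every spun ONE-dimensional
rational representation lands. [difficulty: XL] (why it might fail: Huber–Wüstholz classify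
ℚ̄-LINEAR relations; realising an isogeny/projection relation between two polar curves as finitely
many moves on S²-charts may need correspondences that do not preserve the class [S²] (degree-zero
pieces), leaving a relation true but not visibly a move.) [HuberWustholz2022, DeligneHodgeII1971,
KontsevichZagier2001]
#5 SphericalKernel (crux) — THE CORE (conjecture-grade, GPC-strength, ranked last): every
ℤ-combination c of spherical representations (any dimensions 2m) with KZ.eval c = 0 has a κ-power
multiple in KZ.relations. Equivalently (given SpinNormalForm) the π-local kernel form of
AyoubSpecialisation's stmt-0541 (same pinned-padding P-form); in substance Kontsevich's formal
period conjecture for the closed real pairs ((ℙ¹×ℙ¹)^m ∖ D, [(S²)^m]), whose relators — exactness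
and functoriality, no boundary — are moves by WallFreeExactness and sheet transfer (see Why this
line). Implied by the summit; implies, with SpinNormalForm and PiCancellation, the summit.
[difficulty: open-problem] (why it might fail: contains Grothendieck's period conjecture for
H^{2m}((ℙ¹×ℙ¹)^m ∖ D) against the real fundamental class (barrier GPC-dependence); no strategy
exists; a vanishing ⟨[(S²)^m],ω⟩ not explained by exactness + correspondences would refute
Kontsevich's formal conjecture.) [KontsevichZagier2001, HuberMullerStachPeriods2017,
arXiv:2106.03803, Ayoub2014, Grothendieck1966]
#9 WallFreeExactness (support) — EXACTNESS IS A MOVE ON WALL-FREE REPRESENTATIONS — if R has domain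
all of ℝ^{M+1} and its integrand is ∂_t A along the last coordinate for a ℚ-semialgebraic A
differentiable in t everywhere and tending to 0 as t → ±∞ on every fibre, then KZ.of R ∈
KZ.relations (compactify the fibre by t = s/(1−s²), one Newton–Leibniz move on the band ℝ^M × [−1,1]
with the primitive extended by 0 at s = ±1, and [ℝ^M, 0] is a relation). The algebraic-de-Rham
certificate of an exact spherical density is a sum of M+1 such instances after coordinate
permutations. [difficulty: provable-now] [KontsevichZagier2001, Grothendieck1966]
#9 TwistStable (support) — one more twist keeps a spherical representation spherical — for R
spherical of dimension 2m and every pinned disc padding P there is a spherical R′ of dimension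
2(m+1) with KZ.of (P (2m) R) − KZ.of R′ ∈ KZ.relations (R′ = [ℝ², (1+|w|²)⁻²] ⊗ R, the disc padded
in FRONT becomes the new plane 0 and the planes of R shift by one, or any reindexing of it —
coordinate permutations are changes of variables; chain = the disc ↦ ℝ² map w ↦ w/√(1+|w|²) of
UnitIntervalSpin on the two padded coordinates). Gives the "∀ N ≥ N₀" clause of SpinNormalForm from
its "∃ N" form. [difficulty: M] [KontsevichZagier2001]
#9 UnitIntervalSpin (support) — CALIBRATION 1 — κ·[(0,1), 1], i.e. (rev 1, padding written out) ANY
representation [{z₀²+z₁² ≤ 1, 0 < z₂ < 1}, 1], is KZ-equivalent to the spherical representation [ℝ²,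
(1+|w|²)⁻²] (value π both sides): slab Newton–Leibniz [disc × (0,1)] ~ [disc], then the single
change of variables w ↦ w/√(1+|w|²) from ℝ² onto the open disc (radial, Jacobian (1+|w|²)⁻²) plus
the null boundary circle. The round area form of S² in stereographic coordinates; Archimedes'
hat-box in its smallest instance. [difficulty: provable-now] [KontsevichZagier2001,
DuistermaatHeckman1982]
#9 LogTwoSpin (support) — CALIBRATION 2 — κ·[(1,2), 1/x], i.e. (rev 1) ANY representation [{z₀²+z₁²
≤ 1, 1 < z₂ < 2}, 1/z₂], is KZ-equivalent to the spherical RATIONAL representation [ℝ²,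
1/((1+2|w|²)(1+|w|²))] (value π·log 2 both sides; ∫₀^∞ ds/((1+2s)(1+s)) = log 2): rescale (1,2) to
(−1,1) (z = 2x−3, density 1/(z+3)), then the Archimedes–stereographic move z = (|w|²−1)/(|w|²+1), dz
dt/(1+t²) = 2d²w/(1+|w|²)². This is one half of the closed-period representative R_2 of 2π log 2
found by the in-tree card problem-five-closed-periods-weight-spread (Kummer motive twisted once is
closed); log 2 itself has no spherical representative (weights), so one twist is necessary here.
[difficulty: provable-now] [KontsevichZagier2001, DeligneHodgeII1971]
#9 OneConicLayer (support) — THE SIMPLEST CLOSED VARIETY HAS N = 0 — a spherical representation of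
dimension 2 whose density is P(w)/(1+|w|²)^k (P a ℚ-polynomial; poles only along the anti-diagonal
conic, the complexified S² minus one (1,1)-curve, H² of rank one) with value 0 is itself a relation:
a mean-zero spherical-harmonic density is an explicit divergence with rational potentials, i.e. two
instances of WallFreeExactness. Demonstrates "no transcendental primitive ever" on the first closed
variety and calibrates the engine. [difficulty: provable-now] [Grothendieck1966, DeligneHodgeII1971,
KontsevichZagier2001]

TWO-LAYER PLAN. SpinNormalForm ⇐ ResolvedCellForm → CellSpin → SpinNormalForm (k = 2):
ResolvedCellForm = every rational representation is KZ-equivalent to a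
ℤ-combination of CELL representations [C, f] with C a cylindrical cell over
analytic-up-to-the-closure wall functions and f analytic on a
neighbourhood of the closed cell with integer non-negative exponents along the walls (resolution +
Puiseux uniformisation inside the rules;
cf. VeryGoodTransfer's RationalRepsResolve, shareable); CellSpin = κⁿ·[C, f] is spherical for such
cells (n Archimedes moves + bookkeeping).
SphericalKernel ⇐ (layer by m, or by polar-divisor type): RationalSphereLayer is the m = 1 rational
layer; the m = 1 algebraic layer (branched
double covers of S²: K3/abelian 2-periods) and m = 2 rational layer (π² × curve 1-periods and
products) are the next rungs; none filed now.

KILL CRITERIA. SpinNormalForm refuted SUBSTANTIVELY (a rational representation none of whose κ-power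
multiples has a spherical representative, e.g. because some
corner singularity type is a move-invariant obstruction to analyticity on every (S²)^m) closes the
route `refuted:SpinNormalForm` — the thesis
"walls are π-torsion" is then false as a normal form (a weaker "analytic off codimension 2" version
would be a different, lesser route).
PiCancellation refuted (¬0540, AyoubSpecialisation's 0542) refutes the summit itself; this route
then closes with every positive route.
RationalSphereLayer refuted-misstated (e.g. a level-2 value sneaking into rational dimension-2
spherical densities) ⇒ restate the layer by
polar-divisor type; refuted-substantive (a Huber–Wüstholz relation provably not a κ-local move on
S²) ⇒ pivot: the closed-relator claim of
Why-this-line is wrong and SphericalKernel needs an enlarged relator — retire unless the missing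
relator is itself a named move.
SphericalKernel is conjecture-grade: an `open-problem` stamp is expected, not a kill. Mooted if
AyoubSpecialisation proves 0541 outright.

NOT DECOMPOSED YET. The resolution/uniformisation half of SpinNormalForm (shared in substance with
VeryGoodTransfer's RationalRepsResolve) and its Archimedes
half are not split at open (Two-layer plan). The sheet-transfer engine for functoriality on (S²)^m
(LinkTwistWrithe's DegreeTransfer /
MultivaluedCoV's SheetTransfer, open theorem-candidates elsewhere) is used in the rationale of
SphericalKernel and RationalSphereLayer but not
re-filed here. No statement about closedness/weights is typed (no motives in the tree): the
identification "spherical = closed period of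
((ℙ¹×ℙ¹)^m ∖ D, [(S²)^m])" and the weight-spread consistency check live in the rationale only.
Constants: the exponent N₀(r) ≤ dim r is
expected but not claimed in the Lean statement (∃ N₀ only). CONE (route-repair gen 1, 2026-08-16;
needs-fact: NONE): rev 0 imported
Literature.NumberTheory.Transcendental.KZProductIdeal for κ = `KZ.of KZ.piRep * ·`; KZProduct.lean
hosts the two OPEN @[conjecture] constants
KZ.PiCancellation / KZ.PiLocalKernel ([status: open]), and through the operator-owned Statement
import of PeriodConjecture.lean the statement-equivalents
KZKernelConjecture / KZPeriodConjecture' reach every route of the summit: 4 module-census entries,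
none a dischargeable fact (all summit-grade open
statements; the gate's decl cone of `closes` + items was already 0-unproved / staffable at rev 0).
Rev 1 restates the seven κ-items in the import-free
pinned-padding P-form shared with AyoubSpecialisation (0540/0541) and KatzTower (rev 1), drops the
import (the route file imports nothing beyond the
Statement), and re-proves `closes` crux-only with the padding constructed and its value law proved
inline (planner Sketch.lean rc 0);
PiCancellation is now literally stmt-0540. The two Statement-level entries are operator business, as
recorded by the AyoubSpecialisation (gen 3),
AbelContraction and TwoRouteTransport repairs: drop the unused PeriodConjecture / ComputableReal
imports from
Summits/KontsevichZagierPeriods/KontsevichZagierPeriods/Statement.lean, or let the module census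
skip [status: open] statement-equivalent constants
as the gate's decl cone already does.

CHEAPEST FALSIFIER. (a) By hand, done this session (NOTES.md): κ·[(0,1),1] ↦ [ℝ², (1+|w|²)⁻²] ✓;
κ·[(1,2),1/x] ↦ [ℝ², 1/((1+2|w|²)(1+|w|²))] ✓ (matches the closed
card's R_2 up to the factor 2); κ²·[{0<y<x<1}, 1/x] ↦ [B⁴, |z|⁻²] ↦ [ℝ⁴, 2/(1+|w|⁴)²] ✓ after one
radial-squaring move; the naive spin of
ζ(2) = ∬dxdy/(1−xy) gives 1/((1+|w|²)(1+|z|²)(1+|w|²+|z|²)) on ℝ⁴, which has a POLE at the corner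
point (∞,∞) of (S²)² — so the resolution step
is essential (blowing up (1,1) first makes the corner (unit)×ρ·ρ⁻¹ and the spun density analytic);
and the "fake log 2" [ℝ, G(y(t))y′(t)]
(analytic on ℝ, value log 2, one-sided limits differ at t = ∞) shows the chart condition at infinity
cannot be dropped. (b) The cheapest kill of
SpinNormalForm a refuter can run: exhibit a corner type (e.g. the cusp {0<y<x^{3/2}<1} with
integrand 1/x) whose every κ-multiple, after every
admissible uniformisation, keeps a non-round tangent cone at a pole — then analyticity on (S²)^m
fails for that r. (c) For RationalSphereLayer:
check that 2·[ℝ², (1+2|w|²)⁻²] − [ℝ², (1+|w|²)⁻²] (value 0; a scaling w ↦ √2·w of degree 1) is ONE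
change of variables — it is (rule 2 with
Φ = √2·id, |det| = 2).

NUMBERS. Values used: ∫_{ℝ²} d²w/(1+|w|²)² = π; ∫₀^∞ ds/((1+2s)(1+s)) = log 2; ∫_{ℝ⁴}
d⁴w/(|w|²(1+|w|²)²) = π² = κ²·1 with ∫∫_{0<y<x<1} dxdy/x = 1;
∫_{ℝ⁴} 2d⁴w/(1+|w|⁴)² = π²; ∫∫∫∫ d²w d²z/((1+|w|²)(1+|z|²)(1+|w|²+|z|²)) = π²·∫₀^∞
log(1+s)ds/(s(1+s)) = π²ζ(2) = π⁴/6. Twist count: n per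
dimension-n representation = the worst case of the weight-spread criterion w₂ ≤ 2w₁ after the shift
w ↦ w + 2n (weights of an n-dimensional
representation lie in [0, 2n]; DeligneHodgeII1971).

DEFINITION REQUESTS. None. (A named predicate `KZ.IntegralRep.IsSpherical m R` and a named pinned
disc padding `KZ.discPad n r` in a FACT-FREE module of
Literature/NumberTheory/Transcendental — not KZProduct.lean, which hosts the open π-localisation
conjectures — would shorten the statements that inline
them; to be requested only if a grounder asks — the inline `let Sph := …` and the P-pinning clause
are identical in every item.)

Novelty: Searches (2026-08-16; local searchd DOWN all session — every `lit search --hybrid` returned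
ConnectionReset; OpenAlex anonymous budget exhausted):
`lit search --source arxiv "period conjecture Kontsevich Zagier"` (11 hits: CressonViusos, Viu-Sos
1509.01097, Hörmann 2106.03803 READ pp.1–3,
Bost–Charles 1307.1045, Fresán 2210.03407, Mohajer–Sebbar 2507.15020 — none on boundary elimination
/ closed normal forms); `lit search --source
arxiv "Kontsevich Zagier period conjecture effective periods boundary"` (0); `lit frontier
KontsevichZagierPeriods --since 2022` (30 rows; read
arXiv:2601.19455 "kernel of formal polylogarithms" pp.1–3 — associator sector, unrelated); `lit
galaxy search "closed period" --star all` (45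
rows, all homonyms, as the closed card found on 08-15); full read of all 91 Theses module
docstrings, the 30 open and 131 closed idea cards
(titles + mechanism lines; full text of problem-five-closed-periods-weight-spread,
bending-flows-dh-is-a-move, archimedean-ordered-k0,
unlikely-intersections), the four barrier files, `ledger negatives` (1 entry),
KZProduct/KZProductIdeal/KZKernelConjectureForms sources.
Nearest prior art found: IN TREE — card
KontsevichZagierPeriods/KontsevichZagierPeriods/problem-five-closed-periods-weight-spread (closed
declined:vacuous; motivic side: "Tate twist absorbs boundary via degenerating 𝔾_m-fibrations", π·log
2 closed, weight-spread criterion,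
explicitly "not a summit route" and "closed is invisible in the rules"); cards bending-flows-  [refs: 2601.19455, 2106.03803, KontsevichZagier2001, HuberMullerStachPeriods2017]

Barriers (technique_class: unreduction-normal-form, closed-periods, pi-localisation): - technique_class: unreduction-normal-form, closed-periods, pi-localisation
- Literature.Barriers.KontsevichZagierPeriods.noSemialgebraicPrimitive_inv_sub_two: EVADED
STRUCTURALLY — the barrier's technique class is "eliminate a variable by a primitive OF THE
INTEGRAND inside the admissible class"; on spherical representations a primitive is needed only for
an algebraically EXACT top form, where Grothendieck's algebraic de Rham theorem supplies an
algebraic (n−1)-form, and WallFreeExactness turns it into Newton–Leibniz moves with rational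
primitives; the spin itself uses only rule 2 and additivity.
- Literature.Barriers.KontsevichZagierPeriods.algebraicPrimitivesObstructionNarrow: same evasion;
the narrow witness 2t/(2−t²) − 1/(2−t) on [0,1] is a WALLED representation — its κ-twist is
spherical and its vanishing becomes the exactness of a 2-form on ℙ¹×ℙ¹ minus three curves, decided
there by a rational primitive in TWO variables, consistent with Ayoub's "plus de n+1 variables" (one
twist = one more variable pair).
- Literature.Barriers.KontsevichZagierPeriods.cressonViuSos_prop_3_2: not engaged — no global
semialgebraic homeomorphism between different bodies is ever asserted; every change of variables is
an explicit Archimedes/stereographic/radial map on a cell, and cutting (CAD, resolution charts)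
happens before spinning.
- Literature.Barriers.KontsevichZagierPeriods.kzConjecture_implies_oddZetaAlgIndep: it does not
evade it; the bet is that the GPC-strength content sits ENTIR

History (route lifecycle, newest last):
- 2026-08-16T19:12:37Z · rev 1: restated SpinNormalForm (stmt-KontsevichZagierPeriods-16394), PiCancellation (stmt-KontsevichZagierPeriods-16395), RationalSphereLayer (stmt-KontsevichZagierPeriods-16396), SphericalKernel (stmt-KontsevichZagierPeriods-16397), TwistStable (stmt-KontsevichZagierPeriods-16399), UnitIntervalSpin (stmt-KontsevichZag (planner-rrepair-KontsevichZagierPeriods-Sphere-fbc5f1b0-0)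
- 2026-08-24T11:43:55Z · DORMANT — reconciler: no traction for 6.7 d (last activity item-proof-filed at 2026-08-17T17:12:18Z); parked, not closed — `ledger route dormant route-KontsevichZagierPer (operator:999:3343071)
- 2026-08-30T03:41:11Z · REACTIVATED — reconciler: reactivated — activity statement-attached at 2026-08-30T02:51:58Z after parking at 2026-08-24T11:43:55Z (operator:999:4188919)

sub-problem: KontsevichZagierPeriods · status: open · opened planner-plan-novel-KontsevichZagierPeriods-Kont-0a4ce36c-v2-g6-0 2026-08-16T18:43:30Z · rev 1 · ledger route-KontsevichZagierPeriods-SpheresForWalls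
GENERATED by the gate from the ledger (D-0016/17). Provers cite these decls: `theorem foo : Summit.KontsevichZagierPeriods.KontsevichZagierPeriods.Theses.SpheresForWalls.<Decl> := …` in Summits/KontsevichZagierPeriods/KontsevichZagierPeriods/Theorems/<Name>.lean.
-/

namespace Summit.KontsevichZagierPeriods.KontsevichZagierPeriods.Theses.SpheresForWalls

open scoped BigOperators Topology Manifold Classical MeasureTheory ProbabilityTheory Matrix InnerProductSpace ComplexConjugate ContinuousMap
open Filter Set Function TopologicalSpace MeasureTheory

attribute [summit_statement] _root_.KontsevichZagierPeriods

open Literature Periods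

-- earlier SpinNormalForm (stmt-KontsevichZagierPeriods-16394, replaced 2026-08-16T19:12:37Z -> stmt-KontsevichZagierPeriods-16456): retired by None — let Sph : (m : ℕ) → Literature.NumberTheory.Transcendental.KZ.IntegralRep (m * 2) → Prop := (fun (m : ℕ) (R : Literature.NumberTheory.Transcendental.KZ.IntegralRep (m * 2)) => R.domain = Set.univ ∧ ∀ ε : Fin m → Bool, ∃ K : (Fin (m * 2) → ℝ) → ℝ, (∀ w,
/-- item stmt-KontsevichZagierPeriods-16456 · crux · rank 2 · open · by planner
why it might fail: corner uniformisation must happen BEFORE spinning, walls still available; if some normal-crossings/Puiseux configuration of the CAD wall functions resists, the output is analytic only off codimension 2 — and such densities can hide a boundary (fake log 2 at ∞).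
sources: KontsevichZagier2001, BochnakCosteRoy1998, Hironaka1964, BierstoneMilman1988, DuistermaatHeckman1982
[crux] HAT-BOX NORMAL FORM — for every integral representation r of dimension n there is N₀ such
that for every N ≥ N₀ the twisted class κ^N·[r] = (lift (of ∘ P))^[N] (KZ.of r), P the pinned disc
padding [{z₀²+z₁² ≤ 1} × σ, f ∘ tail²], is KZ-equivalent to a single SPHERICAL representation R of
some dimension 2m: domain all of ℝ^{2m}, integrand analytic at every point, and analytic again after
inverting any sub-family of the m coordinate planes (chart condition spelled out inline: for each ε
: Fin m → Bool an everywhere-analytic K agreeing, off the inverted planes' origins, with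
R.integrand(inv_ε w)·∏_{ε k}|w_k|⁻⁴). Intended proof: CAD; embedded resolution so the integrand is
(unit)×(monomial with exponents > −1) at every corner of every cell; power substitutions making the
exponents non-negative integers and the cell-wall functions analytic across the base walls; affine
rescaling of each fibre interval to (−1,1); the Archimedes–stereographic change of variables per
padded disc (κ each, both walls ↦ the two poles); integrand additivity merges the cells on the
common domain ℝ^{2m}; extra κ's are absorbed by TwistStable. [difficulty: L] (Rev 1 cone repair
2026-08-16: import-free pinne -/
@[route_item "route-KontsevichZagierPeriods-SpheresForWalls", crux]
def SpinNormalForm : Prop :=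
  let Sph : (m : ℕ) → Literature.NumberTheory.Transcendental.KZ.IntegralRep (m * 2) → Prop := (fun (m : ℕ) (R : Literature.NumberTheory.Transcendental.KZ.IntegralRep (m * 2)) => R.domain = Set.univ ∧ ∀ ε : Fin m → Bool, ∃ K : (Fin (m * 2) → ℝ) → ℝ, (∀ w, AnalyticAt ℝ K w) ∧ ∀ w : Fin (m * 2) → ℝ, (∀ k : Fin m, ε k = true → w (finProdFinEquiv (k, (0 : Fin 2))) ^ 2 + w (finProdFinEquiv (k, (1 : Fin 2))) ^ 2 ≠ 0) → K w = R.integrand (fun i : Fin (m * 2) => if ε (finProdFinEquiv.symm i).1 = true then w i / (w (finProdFinEquiv ((finProdFinEquiv.symm i).1, (0 : Fin 2))) ^ 2 + w (finProdFinEquiv ((finProdFinEquiv.symm i).1, (1 : Fin 2))) ^ 2) else w i) * ∏ k : Fin m, (if ε k = true then ((w (finProdFinEquiv (k, (0 : Fin 2))) ^ 2 + w (finProdFinEquiv (k, (1 : Fin 2))) ^ 2)⁻¹) ^ 2 else 1)); ∀ (P : ∀ n : ℕ, Literature.NumberTheory.Transcendental.KZ.IntegralRep n → Literature.NumberTheory.Transcendental.KZ.IntegralRep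 (n + 2)), (∀ (n : ℕ) (r : Literature.NumberTheory.Transcendental.KZ.IntegralRep n), (P n r).domain = {z : Fin (n + 2) → ℝ | z 0 ^ 2 + z 1 ^ 2 ≤ 1 ∧ (fun i : Fin n => z i.succ.succ) ∈ r.domain} ∧ (P n r).integrand = fun z => r.integrand (fun i : Fin n => z i.succ.succ)) → ∀ (n : ℕ) (r : Literature.NumberTheory.Transcendental.KZ.IntegralRep n), ∃ N₀ : ℕ, ∀ N : ℕ, N₀ ≤ N → ∃ (m : ℕ) (R : Literature.NumberTheory.Transcendental.KZ.IntegralRep (m * 2)), Sph m R ∧ (⇑(FreeAbelianGroup.lift (fun s : (Σ n, Literature.NumberTheory.Transcendental.KZ.IntegralRep n) => Literature.NumberTheory.Transcendental.KZ.of (P s.1 s.2))))^[N] (Literature.NumberTheory.Transcendental.KZ.of r) - Literature.NumberTheory.Transcendental.KZ.of R ∈ Literature.NumberTheory.Transcendental.KZ.relations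

-- earlier PiCancellation (stmt-KontsevichZagierPeriods-16395, replaced 2026-08-16T19:12:37Z -> stmt-KontsevichZagierPeriods-0540): retired by None — ∀ c : Literature.NumberTheory.Transcendental.KZ.FormalRep, Literature.NumberTheory.Transcendental.KZ.of Literature.NumberTheory.Transcendental.KZ.piRep * c ∈ Literature.NumberTheory.Transcendental.KZ.relations → c ∈ Literature.NumberTheory.Transcendenta
/-- item stmt-KontsevichZagierPeriods-0540 · crux · rank 3 · open · by planner
why it might fail: a true identity reachable only through an auxiliary factor of π (effective period MONOID vs motivic GROUP, AyoubRelKZRevisited Rem. 1.3; HMS §13.1 P^eff vs P^eff[(2πi)⁻¹]) would refute it and, with it, the H21-literal summit (route Neg's bet).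
sources: Ayoub2014, AyoubRelKZRevisited, HuberMullerStachPeriods2017, HuberWustholz2022
PiCancellation := ∀ c : Literature.NumberTheory.Transcendental.KZ.FormalRep, (of piRep) ⋆ c ∈
Literature.NumberTheory.Transcendental.KZ.relations → c ∈
Literature.NumberTheory.Transcendental.KZ.relations, piRep = closed unit disc with integrand 1 (d =
2). A consequence of S (eval (piRep ⋆ c) = π · eval c by Fubini, π ≠ 0), but transcendence-free: it
is a regular-element property of the presented abelian group FormalRep/relations under the product,
and the exact point where Ayoub's relative theorem fails to be effective (AyoubRelKZRevisited Rem
1.3: the torsor exists only over D((2πi)⁻¹)) and where HuberMullerStach2017 §13 passes from P^eff to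
P = P^eff[(2πi)⁻¹]. Independent of the chosen π-representation once `relations` is an ideal under ⋆
(part of the def request). Attack suggestions: (i) normal forms for ⋆-multiples of disc reps (the
disc factor occupies two leading coordinates untouched by NL along the last coordinate; CoV may mix
them — the crux is whether a relation certificate for piRep ⋆ c can be 'projected' to one for c,
e.g. by restricting/fibrewise-specialising the disc coordinates at a rational point and using domain
additivity); (ii) small cases: c supported in dimensi -/
@[route_item "route-KontsevichZagierPeriods-SpheresForWalls", crux]
def PiCancellation : Prop :=
  ∀ (P : ∀ n : ℕ, Literature.NumberTheory.Transcendental.KZ.IntegralRep n → Literature.NumberTheory.Transcendental.KZ.IntegralRep (n + 2)), (∀ (n : ℕ) (r : Literature.NumberTheory.Transcendental.KZ.IntegralRep n), (P n r).domain = {z : Fin (n + 2) → ℝ | z 0 ^ 2 + z 1 ^ 2 ≤ 1 ∧ (fun i : Fin n => z i.succ.succ) ∈ r.domain} ∧ (P n r).integrand = fun z => r.integrand (fun i : Fin n => z i.succ.succ)) → ∀ c : Literature.NumberTheory.Transcendental.KZ.FormalRep, FreeAbelianGroup.lift (fun s : (Σ n, Literature.NumberTheory.Transcendental.KZ.IntegralRep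 n) => Literature.NumberTheory.Transcendental.KZ.of (P s.1 s.2)) c ∈ Literature.NumberTheory.Transcendental.KZ.relations → c ∈ Literature.NumberTheory.Transcendental.KZ.relations

-- earlier SphericalKernel (stmt-KontsevichZagierPeriods-16397, replaced 2026-08-16T19:12:37Z -> stmt-KontsevichZagierPeriods-16458): retired by None — let Sph : (m : ℕ) → Literature.NumberTheory.Transcendental.KZ.IntegralRep (m * 2) → Prop := (fun (m : ℕ) (R : Literature.NumberTheory.Transcendental.KZ.IntegralRep (m * 2)) => R.domain = Set.univ ∧ ∀ ε : Fin m → Bool, ∃ K : (Fin (m * 2) → ℝ) → ℝ, (∀ w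
/-- item stmt-KontsevichZagierPeriods-16458 · crux · rank 5 · open · by planner
why it might fail: contains Grothendieck's period conjecture for H^{2m}((ℙ¹×ℙ¹)^m ∖ D) against the real fundamental class (barrier GPC-dependence); no strategy exists; a vanishing ⟨[(S²)^m],ω⟩ not explained by exactness + correspondences would refute Kontsevich's formal conjecture.
sources: KontsevichZagier2001, HuberMullerStachPeriods2017, arXiv:2106.03803, Ayoub2014, Grothendieck1966
[crux] THE CORE (conjecture-grade, GPC-strength, ranked last): for every pinned disc padding P,
every ℤ-combination c of spherical representations (any dimensions 2m) with KZ.eval c = 0 has (lift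
(of ∘ P))^[N] c ∈ KZ.relations for some N. Equivalently (given SpinNormalForm) the π-local kernel
form of AyoubSpecialisation's stmt-0541 (same P-form) restricted to the spherical span; in substance
Kontsevich's formal period conjecture for the closed real pairs ((ℙ¹×ℙ¹)^m ∖ D, [(S²)^m]), whose
relators — exactness and functoriality, no boundary — are moves by WallFreeExactness and sheet
transfer. Implied by the summit; implies, with SpinNormalForm and PiCancellation, the summit.
[difficulty: open-problem] (Rev 1 cone repair 2026-08-16: import-free pinned-padding P-form — ∀ P :
∀ n, IntegralRep n → IntegralRep (n+2) pinned by domain {z | z 0²+z 1² ≤ 1 ∧ tail² z ∈ r.domain} and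
integrand r.integrand ∘ tail², κ = FreeAbelianGroup.lift (of ∘ P); no KZProduct import.) -/
@[route_item "route-KontsevichZagierPeriods-SpheresForWalls", crux]
def SphericalKernel : Prop :=
  let Sph : (m : ℕ) → Literature.NumberTheory.Transcendental.KZ.IntegralRep (m * 2) → Prop := (fun (m : ℕ) (R : Literature.NumberTheory.Transcendental.KZ.IntegralRep (m * 2)) => R.domain = Set.univ ∧ ∀ ε : Fin m → Bool, ∃ K : (Fin (m * 2) → ℝ) → ℝ, (∀ w, AnalyticAt ℝ K w) ∧ ∀ w : Fin (m * 2) → ℝ, (∀ k : Fin m, ε k = true → w (finProdFinEquiv (k, (0 : Fin 2))) ^ 2 + w (finProdFinEquiv (k, (1 : Fin 2))) ^ 2 ≠ 0) → K w = R.integrand (fun i : Fin (m * 2) => if ε (finProdFinEquiv.symm i).1 = true then w i / (w (finProdFinEquiv ((finProdFinEquiv.symm i).1, (0 : Fin 2))) ^ 2 + w (finProdFinEquiv ((finProdFinEquiv.symm i).1, (1 : Fin 2))) ^ 2) else w i) * ∏ k : Fin m, (if ε k = true then ((w (finProdFinEquiv (k, (0 : Fin 2))) ^ 2 + w (finProdFinEquiv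 (k, (1 : Fin 2))) ^ 2)⁻¹) ^ 2 else 1)); ∀ (P : ∀ n : ℕ, Literature.NumberTheory.Transcendental.KZ.IntegralRep n → Literature.NumberTheory.Transcendental.KZ.IntegralRep (n + 2)), (∀ (n : ℕ) (r : Literature.NumberTheory.Transcendental.KZ.IntegralRep n), (P n r).domain = {z : Fin (n + 2) → ℝ | z 0 ^ 2 + z 1 ^ 2 ≤ 1 ∧ (fun i : Fin n => z i.succ.succ) ∈ r.domain} ∧ (P n r).integrand = fun z => r.integrand (fun i : Fin n => z i.succ.succ)) → ∀ c : Literature.NumberTheory.Transcendental.KZ.FormalRep, c ∈ AddSubgroup.closure {x : Literature.NumberTheory.Transcendental.KZ.FormalRep | ∃ (m : ℕ) (R : Literature.NumberTheory.Transcendental.KZ.IntegralRep (m * 2)), Sph m R ∧ x = Literature.NumberTheory.Transcendental.KZ.of R} → Literature.NumberTheory.Transcendental.KZ.eval c = 0 → ∃ N : ℕ, (⇑(FreeAbelianGroup.lift (fun s : (Σ n, Literature.NumberTheory.Transcendental.KZ.IntegralRep n) => Literature.NumberTheory.Transcendental.KZ.of (P s.1 s.2))))^[N] c ∈ Literatu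re.NumberTheory.Transcendental.KZ.relations

-- earlier RationalSphereLayer (stmt-KontsevichZagierPeriods-16396, replaced 2026-08-16T19:12:37Z -> stmt-KontsevichZagierPeriods-16457): retired by None — let Sph : (m : ℕ) → Literature.NumberTheory.Transcendental.KZ.IntegralRep (m * 2) → Prop := (fun (m : ℕ) (R : Literature.NumberTheory.Transcendental.KZ.IntegralRep (m * 2)) => R.domain = Set.univ ∧ ∀ ε : Fin m → Bool, ∃ K : (Fin (m * 2) → ℝ) → ℝ, 
/-- item stmt-KontsevichZagierPeriods-16457 · aside · rank 4 · open · by planner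
why it might fail: Huber–Wüstholz classify ℚ̄-LINEAR relations; realising an isogeny/projection relation between two polar curves as finitely many moves on S²-charts may need correspondences that do not preserve the class [S²] (degree-zero pieces), leaving a relation true but not visibly a move.
sources: HuberWustholz2022, DeligneHodgeII1971, KontsevichZagier2001
[crux] FIRST DECIDED LAYER of SphericalKernel — for every pinned disc padding P: on the span of the
spherical representations of dimension 2 whose density is a quotient of ℚ-polynomials (one sphere,
poles along finitely many conics/curves disjoint from S²), every vanishing ℤ-combination c has (lift
(of ∘ P))^[N] c ∈ KZ.relations for some N. Such values are π × (1-periods of the polar curves: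
logarithms of algebraic numbers, complete elliptic/abelian integrals, algebraic numbers; level ≤ 1
by the in-tree HodgeLevel lemma), so Huber–Wüstholz (HuberWustholz2022 Thm 13.3) DECIDES which
combinations vanish; the crux is that each generator is realised on the sphere by WallFreeExactness
(exactness), a sheeted change of variables of S² (functoriality) and the real structure
(orientation-reversing symmetry), up to κ-twists. The layer where every spun ONE-dimensional
rational representation lands. [difficulty: XL] (Rev 1 cone repair 2026-08-16: import-free
pinned-padding P-form — ∀ P : ∀ n, IntegralRep n → IntegralRep (n+2) pinned by domain {z | z 0²+z 1²
≤ 1 ∧ tail² z ∈ r.domain} and integrand r.integrand ∘ tail², κ = FreeAbelianGroup.lift (of ∘ P); no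
KZProduct import.) -/
@[route_item "route-KontsevichZagierPeriods-SpheresForWalls", crux]
def RationalSphereLayer : Prop :=
  let Sph : (m : ℕ) → Literature.NumberTheory.Transcendental.KZ.IntegralRep (m * 2) → Prop := (fun (m : ℕ) (R : Literature.NumberTheory.Transcendental.KZ.IntegralRep (m * 2)) => R.domain = Set.univ ∧ ∀ ε : Fin m → Bool, ∃ K : (Fin (m * 2) → ℝ) → ℝ, (∀ w, AnalyticAt ℝ K w) ∧ ∀ w : Fin (m * 2) → ℝ, (∀ k : Fin m, ε k = true → w (finProdFinEquiv (k, (0 : Fin 2))) ^ 2 + w (finProdFinEquiv (k, (1 : Fin 2))) ^ 2 ≠ 0) → K w = R.integrand (fun i : Fin (m * 2) => if ε (finProdFinEquiv.symm i).1 = true then w i / (w (finProdFinEquiv ((finProdFinEquiv.symm i).1, (0 : Fin 2))) ^ 2 + w (finProdFinEquiv ((finProdFinEquiv.symm i).1, (1 : Fin 2))) ^ 2) else w i) * ∏ k : Fin m, (if ε k = true then ((w (finProdFinEquiv (k, (0 : Fin 2))) ^ 2 + w (finProdFinEquiv (k, (1 : Fin 2))) ^ 2)⁻¹) ^ 2 else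 1)); ∀ (P : ∀ n : ℕ, Literature.NumberTheory.Transcendental.KZ.IntegralRep n → Literature.NumberTheory.Transcendental.KZ.IntegralRep (n + 2)), (∀ (n : ℕ) (r : Literature.NumberTheory.Transcendental.KZ.IntegralRep n), (P n r).domain = {z : Fin (n + 2) → ℝ | z 0 ^ 2 + z 1 ^ 2 ≤ 1 ∧ (fun i : Fin n => z i.succ.succ) ∈ r.domain} ∧ (P n r).integrand = fun z => r.integrand (fun i : Fin n => z i.succ.succ)) → ∀ c : Literature.NumberTheory.Transcendental.KZ.FormalRep, c ∈ AddSubgroup.closure {x : Literature.NumberTheory.Transcendental.KZ.FormalRep | ∃ (R : Literature.NumberTheory.Transcendental.KZ.IntegralRep (1 * 2)) (p q : MvPolynomial (Fin (1 * 2)) ℚ), Sph 1 R ∧ (∀ w : Fin (1 * 2) → ℝ, MvPolynomial.aeval w q ≠ 0) ∧ (R.integrand = fun w => MvPolynomial.aeval w p / MvPolynomial.aeval w q) ∧ x = Literature.NumberTheory.Transcendental.KZ.of R} → Literature.NumberTheory.Transcendental.KZ.eval c = 0 → ∃ N : ℕ, (⇑(FreeAbelianGroup.lift (fun s : (Σ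 n, Literature.NumberTheory.Transcendental.KZ.IntegralRep n) => Literature.NumberTheory.Transcendental.KZ.of (P s.1 s.2))))^[N] c ∈ Literature.NumberTheory.Transcendental.KZ.relations

/-- item stmt-KontsevichZagierPeriods-16398 · support · rank 9 · closed · proved by Summit.KontsevichZagierPeriods.SpheresForWalls.wallFreeExactness_proof @ 941ac325179d (prover) · by planner
sources: KontsevichZagier2001, Grothendieck1966
[support] EXACTNESS IS A MOVE ON WALL-FREE REPRESENTATIONS — if R has domain all of ℝ^{M+1} and its
integrand is ∂_t A along the last coordinate for a ℚ-semialgebraic A differentiable in t everywhere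
and tending to 0 as t → ±∞ on every fibre, then KZ.of R ∈ KZ.relations (compactify the fibre by t =
s/(1−s²), one Newton–Leibniz move on the band ℝ^M × [−1,1] with the primitive extended by 0 at s =
±1, and [ℝ^M, 0] is a relation). The algebraic-de-Rham certificate of an exact spherical density is
a sum of M+1 such instances after coordinate permutations. [difficulty: provable-now] -/
@[route_item "route-KontsevichZagierPeriods-SpheresForWalls"]
def WallFreeExactness : Prop :=
  ∀ (M : ℕ) (R : Literature.NumberTheory.Transcendental.KZ.IntegralRep (M + 1)) (A : (Fin (M + 1) → ℝ) → ℝ), R.domain = Set.univ → Literature.NumberTheory.Transcendental.IsSemialgebraicFunOn ℚ Set.univ A → (∀ (x : Fin M → ℝ) (t : ℝ), HasDerivAt (fun s : ℝ => A (Fin.snoc x s)) (R.integrand (Fin.snoc x t)) t) → (∀ x : Fin M → ℝ, Filter.Tendsto (fun t : ℝ => A (Fin.snoc x t)) Filter.atTop (nhds 0)) → (∀ x : Fin M → ℝ, Filter.Tendsto (fun t : ℝ => A (Fin.snoc x t)) Filter.atBot (nhds 0)) → Literature.NumberTheory.Transcendental.KZ.of R ∈ Literature.NumberTheory.Transcen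dental.KZ.relations

-- `WallFreeExactness` holds: proved by `Summit.KontsevichZagierPeriods.SpheresForWalls.wallFreeExactness_proof` @ 941ac325179d (its module imports this route file, so no `_holds` link can be stated here).

/-- item stmt-KontsevichZagierPeriods-16402 · support · rank 9 · closed · proved by Summit.KontsevichZagierPeriods.SpheresForWalls.oneConicLayer_proof @ f942c5033600 (prover) · by planner
sources: Grothendieck1966, DeligneHodgeII1971, KontsevichZagier2001
[support] THE SIMPLEST CLOSED VARIETY HAS N = 0 — a spherical representation of dimension 2 whose
density is P(w)/(1+|w|²)^k (P a ℚ-polynomial; poles only along the anti-diagonal conic, the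
complexified S² minus one (1,1)-curve, H² of rank one) with value 0 is itself a relation: a
mean-zero spherical-harmonic density is an explicit divergence with rational potentials, i.e. two
instances of WallFreeExactness. Demonstrates "no transcendental primitive ever" on the first closed
variety and calibrates the engine. [difficulty: provable-now] -/
@[route_item "route-KontsevichZagierPeriods-SpheresForWalls"]
def OneConicLayer : Prop :=
  let Sph : (m : ℕ) → Literature.NumberTheory.Transcendental.KZ.IntegralRep (m * 2) → Prop := (fun (m : ℕ) (R : Literature.NumberTheory.Transcendental.KZ.IntegralRep (m * 2)) => R.domain = Set.univ ∧ ∀ ε : Fin m → Bool, ∃ K : (Fin (m * 2) → ℝ) → ℝ, (∀ w, AnalyticAt ℝ K w) ∧ ∀ w : Fin (m * 2) → ℝ, (∀ k : Fin m, ε k = true → w (finProdFinEquiv (k, (0 : Fin 2))) ^ 2 + w (finProdFinEquiv (k, (1 : Fin 2))) ^ 2 ≠ 0) → K w = R.integrand (fun i : Fin (m * 2) => if ε (finProdFinEquiv.symm i).1 = true then w i / (w (finProdFinEquiv ((finProdFinEquiv.symm i).1, (0 : Fin 2))) ^ 2 + w (finProdFinEquiv ((finProdFinEquiv.symm i).1,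 (1 : Fin 2))) ^ 2) else w i) * ∏ k : Fin m, (if ε k = true then ((w (finProdFinEquiv (k, (0 : Fin 2))) ^ 2 + w (finProdFinEquiv (k, (1 : Fin 2))) ^ 2)⁻¹) ^ 2 else 1)); ∀ (R : Literature.NumberTheory.Transcendental.KZ.IntegralRep (1 * 2)) (p : MvPolynomial (Fin (1 * 2)) ℚ) (k : ℕ), Sph 1 R → (R.integrand = fun w => MvPolynomial.aeval w p / (1 + (w (finProdFinEquiv ((0 : Fin 1), (0 : Fin 2))) ^ 2 + w (finProdFinEquiv ((0 : Fin 1), (1 : Fin 2))) ^ 2)) ^ k) → Literature.NumberTheory.Transcendental.KZ.eval (Literature.NumberTheory.Transcendental.KZ.of R) = 0 → Literature.NumberTheory.Transcendental.KZ.of R ∈ Literature.NumberTheory.Transcendental.KZ.relations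

-- `OneConicLayer` holds: proved by `Summit.KontsevichZagierPeriods.SpheresForWalls.oneConicLayer_proof` @ f942c5033600 (its module imports this route file, so no `_holds` link can be stated here).

-- earlier TwistStable (stmt-KontsevichZagierPeriods-16399, replaced 2026-08-16T19:12:37Z -> stmt-KontsevichZagierPeriods-16459): retired by None — let Sph : (m : ℕ) → Literature.NumberTheory.Transcendental.KZ.IntegralRep (m * 2) → Prop := (fun (m : ℕ) (R : Literature.NumberTheory.Transcendental.KZ.IntegralRep (m * 2)) => R.domain = Set.univ ∧ ∀ ε : Fin m → Bool, ∃ K : (Fin (m * 2) → ℝ) → ℝ, (∀ w, An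
/-- item stmt-KontsevichZagierPeriods-16459 · support · rank 9 · open · by planner
sources: KontsevichZagier2001
[support] one more twist keeps a spherical representation spherical — for every pinned disc padding
P and every spherical R of dimension 2m there is a spherical R′ of dimension 2(m+1) with KZ.of (P
(2m) R) − KZ.of R′ ∈ KZ.relations (R′ = [ℝ², (1+|w|²)⁻²] ⊗ R: the disc padded in front becomes the
new plane 0 and the planes of R shift by one, or any reindexing of it — coordinate permutations are
changes of variables; chain = the disc ↦ ℝ² map w ↦ w/√(1+|w|²) of UnitIntervalSpin on the two
padded coordinates). Gives the '∀ N ≥ N₀' clause of SpinNormalForm from its '∃ N' form. [difficulty: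
M] (Rev 1 cone repair 2026-08-16: import-free pinned-padding P-form — ∀ P : ∀ n, IntegralRep n →
IntegralRep (n+2) pinned by domain {z | z 0²+z 1² ≤ 1 ∧ tail² z ∈ r.domain} and integrand
r.integrand ∘ tail², κ = FreeAbelianGroup.lift (of ∘ P); no KZProduct import.) -/
@[route_item "route-KontsevichZagierPeriods-SpheresForWalls"]
def TwistStable : Prop :=
  let Sph : (m : ℕ) → Literature.NumberTheory.Transcendental.KZ.IntegralRep (m * 2) → Prop := (fun (m : ℕ) (R : Literature.NumberTheory.Transcendental.KZ.IntegralRep (m * 2)) => R.domain = Set.univ ∧ ∀ ε : Fin m → Bool, ∃ K : (Fin (m * 2) → ℝ) → ℝ, (∀ w, AnalyticAt ℝ K w) ∧ ∀ w : Fin (m * 2) → ℝ, (∀ k : Fin m, ε k = true → w (finProdFinEquiv (k, (0 : Fin 2))) ^ 2 + w (finProdFinEquiv (k, (1 : Fin 2))) ^ 2 ≠ 0) → K w = R.integrand (fun i : Fin (m * 2) => if ε (finProdFinEquiv.symm i).1 = true then w i / (w (finProdFinEquiv ((finProdFinEquiv.symm i).1, (0 : Fin 2))) ^ 2 + w (finProdFinEquiv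 ((finProdFinEquiv.symm i).1, (1 : Fin 2))) ^ 2) else w i) * ∏ k : Fin m, (if ε k = true then ((w (finProdFinEquiv (k, (0 : Fin 2))) ^ 2 + w (finProdFinEquiv (k, (1 : Fin 2))) ^ 2)⁻¹) ^ 2 else 1)); ∀ (P : ∀ n : ℕ, Literature.NumberTheory.Transcendental.KZ.IntegralRep n → Literature.NumberTheory.Transcendental.KZ.IntegralRep (n + 2)), (∀ (n : ℕ) (r : Literature.NumberTheory.Transcendental.KZ.IntegralRep n), (P n r).domain = {z : Fin (n + 2) → ℝ | z 0 ^ 2 + z 1 ^ 2 ≤ 1 ∧ (fun i : Fin n => z i.succ.succ) ∈ r.domain} ∧ (P n r).integrand = fun z => r.integrand (fun i : Fin n => z i.succ.succ)) → ∀ (m : ℕ) (R : Literature.NumberTheory.Transcendental.KZ.IntegralRep (m * 2)), Sph m R → ∃ R' : Literature.NumberTheory.Transcendental.KZ.IntegralRep ((m + 1) * 2), Sph (m + 1) R' ∧ Literature.NumberTheory.Transcendental.KZ.of (P (m * 2) R) - Literature.NumberTheory.Transcendental.KZ.of R' ∈ Literature.NumberTheory.Transcendental.KZ.relations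

-- earlier UnitIntervalSpin (stmt-KontsevichZagierPeriods-16400, replaced 2026-08-16T19:12:37Z -> stmt-KontsevichZagierPeriods-16460): retired by None — ∀ (r : Literature.NumberTheory.Transcendental.KZ.IntegralRep 1) (R : Literature.NumberTheory.Transcendental.KZ.IntegralRep 2), r.domain = {x | 0 < x 0 ∧ x 0 < 1} → (∀ x ∈ r.domain, r.integrand x = 1) → R.domain = Set.univ → (R.integrand = fun w => ((
/-- item stmt-KontsevichZagierPeriods-16460 · support · rank 9 · closed · proved by Summit.KontsevichZagierPeriods.SpheresForWalls.unitIntervalSpin_proof @ e69e2d96c9ad (prover) · by planner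
sources: KontsevichZagier2001, DuistermaatHeckman1982
[support] CALIBRATION 1 — κ·[(0,1), 1], written out (rev 1, P-free) as ANY representation ρ =
[{z₀²+z₁² ≤ 1, 0 < z₂ < 1}, 1] (the pinned padding P 1 [(0,1),1] is one), is KZ-equivalent to the
spherical representation [ℝ², (1+|w|²)⁻²] (value π both sides): slab Newton–Leibniz [disc × (0,1)] ~
[disc], then the single change of variables w ↦ w/√(1+|w|²) from ℝ² onto the open disc (radial,
Jacobian (1+|w|²)⁻²) plus the null boundary circle. The round area form of S² in stereographic
coordinates; Archimedes' hat-box in its smallest instance. [difficulty: provable-now] -/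
@[route_item "route-KontsevichZagierPeriods-SpheresForWalls"]
def UnitIntervalSpin : Prop :=
  ∀ (ρ : Literature.NumberTheory.Transcendental.KZ.IntegralRep 3) (R : Literature.NumberTheory.Transcendental.KZ.IntegralRep 2), ρ.domain = {z | z 0 ^ 2 + z 1 ^ 2 ≤ 1 ∧ 0 < z 2 ∧ z 2 < 1} → (∀ z ∈ ρ.domain, ρ.integrand z = 1) → R.domain = Set.univ → (R.integrand = fun w => ((1 + (w 0 ^ 2 + w 1 ^ 2)) ^ 2)⁻¹) → Literature.NumberTheory.Transcendental.KZ.of ρ - Literature.NumberTheory.Transcendental.KZ.of R ∈ Literature.NumberTheory.Transcendental.KZ.relations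

-- `UnitIntervalSpin` holds: proved by `Summit.KontsevichZagierPeriods.SpheresForWalls.unitIntervalSpin_proof` @ e69e2d96c9ad (its module imports this route file, so no `_holds` link can be stated here).

-- earlier LogTwoSpin (stmt-KontsevichZagierPeriods-16401, replaced 2026-08-16T19:12:37Z -> stmt-KontsevichZagierPeriods-16461): retired by None — ∀ (r : Literature.NumberTheory.Transcendental.KZ.IntegralRep 1) (R : Literature.NumberTheory.Transcendental.KZ.IntegralRep 2), r.domain = {x | 1 < x 0 ∧ x 0 < 2} → (∀ x ∈ r.domain, r.integrand x = (x 0)⁻¹) → R.domain = Set.univ → (R.integrand = fun w => ((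
/-- item stmt-KontsevichZagierPeriods-16461 · support · rank 9 · closed · proved by Summit.KontsevichZagierPeriods.SpheresForWalls.logTwoSpin_proof @ 9da1a822d32a (prover) · by planner
sources: KontsevichZagier2001, DeligneHodgeII1971
[support] CALIBRATION 2 — κ·[(1,2), 1/x], written out (rev 1, P-free) as ANY representation ρ =
[{z₀²+z₁² ≤ 1, 1 < z₂ < 2}, 1/z₂], is KZ-equivalent to the spherical RATIONAL representation [ℝ²,
1/((1+2|w|²)(1+|w|²))] (value π·log 2 both sides; ∫₀^∞ ds/((1+2s)(1+s)) = log 2): rescale (1,2) to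
(−1,1) (z = 2x−3, density 1/(z+3)), then the Archimedes–stereographic move z = (|w|²−1)/(|w|²+1), dz
dt/(1+t²) = 2d²w/(1+|w|²)². One half of the closed-period representative R_2 of 2π log 2 of the
in-tree card problem-five-closed-periods-weight-spread (Kummer motive twisted once is closed); log 2
itself has no spherical representative (weights), so one twist is necessary here. [difficulty:
provable-now] -/
@[route_item "route-KontsevichZagierPeriods-SpheresForWalls"]
def LogTwoSpin : Prop :=
  ∀ (ρ : Literature.NumberTheory.Transcendental.KZ.IntegralRep 3) (R : Literature.NumberTheory.Transcendental.KZ.IntegralRep 2), ρ.domain = {z | z 0 ^ 2 + z 1 ^ 2 ≤ 1 ∧ 1 < z 2 ∧ z 2 < 2} → (∀ z ∈ ρ.domain, ρ.integrand z = (z 2)⁻¹) → R.domain = Set.univ → (R.integrand = fun w => ((1 + 2 * (w 0 ^ 2 + w 1 ^ 2)) * (1 + (w 0 ^ 2 + w 1 ^ 2)))⁻¹) → Literature.NumberTheory.Transcendental.KZ.of ρ - Literature.NumberTheory.Transcendental.KZ.of R ∈ Literature.NumberTheory.Transcendental.KZ.relations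

-- `LogTwoSpin` holds: proved by `Summit.KontsevichZagierPeriods.SpheresForWalls.logTwoSpin_proof` @ 9da1a822d32a (its module imports this route file, so no `_holds` link can be stated here).

/-- item stmt-KontsevichZagierPeriods-16403 · assembly · rank 1 · closed · proved by Summit.KontsevichZagierPeriods.SpheresForWalls.assembly_proof @ 84c287f596e5 (prover) · by planner
sources: KontsevichZagier2001, HuberMullerStachPeriods2017
[assembly] SpinNormalForm → PiCancellation → RationalSphereLayer → SphericalKernel → the summit
statement. -/
@[route_item "route-KontsevichZagierPeriods-SpheresForWalls"]
def Assembly : Prop :=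
  SpinNormalForm → PiCancellation → RationalSphereLayer → SphericalKernel → KontsevichZagierPeriods

-- `Assembly` holds: proved by `Summit.KontsevichZagierPeriods.SpheresForWalls.assembly_proof` @ 84c287f596e5 (its module imports this route file, so no `_holds` link can be stated here).

/-! D-0027 §2.1 — DECIDING THEOREM (planner-authored via `route open/edit --closes-file`; by planner-rrepair-KontsevichZagierPeriods-Sphere-fbc5f1b0-0 2026-08-16T19:12:37Z):
its hypotheses are this route's items and its conclusion the sub-problem Statement (glue_lint), and it elaborates with this file. -/

@[closes "route-KontsevichZagierPeriods-SpheresForWalls"] theorem closes (hS : SpinNormalForm) (hP : PiCancellation) (hL : RationalSphereLayer)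
    (hK : SphericalKernel) : KontsevichZagierPeriods := by
  clear hL
  -- (0) area of the unit disc (`Complex.volume_closedBall` along `Complex.measurableEquivRealProd`)
  have hdisc : volume {p : ℝ × ℝ | p.1 ^ 2 + p.2 ^ 2 ≤ 1} = ENNReal.ofReal Real.pi := by
    have hmeas : MeasurableSet {p : ℝ × ℝ | p.1 ^ 2 + p.2 ^ 2 ≤ 1} :=
      (isClosed_le (by fun_prop) continuous_const).measurableSet
    have hpre : Complex.measurableEquivRealProd ⁻¹' {p : ℝ × ℝ | p.1 ^ 2 + p.2 ^ 2 ≤ 1} =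
        Metric.closedBall (0 : ℂ) 1 := by
      ext a
      rw [mem_preimage, mem_setOf_eq, Complex.measurableEquivRealProd_apply,
        mem_closedBall_zero_iff, ← sq_le_one_iff₀ (norm_nonneg a), Complex.sq_norm,
        Complex.normSq_apply]
      simp [sq]
    rw [← Complex.volume_preserving_equiv_real_prod.measure_preimage hmeas.nullMeasurableSet,
      hpre, Complex.volume_closedBall, ENNReal.ofReal_one, one_pow, one_mul,
      ← NNReal.coe_real_pi, ENNReal.ofReal_coe_nnreal]
  -- (1) the pinned disc padding `P n r = [{z₀² + z₁² ≤ 1} × σ, f ∘ tail²]` EXISTS and has value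
  -- `π · value r`: semialgebraicity by coordinate preimages (as in route AyoubSpecialisation's
  -- deciding theorem), integrability and the VALUE LAW by Fubini along `ℝⁿ⁺² ≃ᵐ (ℝ × ℝ) × ℝⁿ`.
  have key : ∀ (n : ℕ) (r : NumberTheory.Transcendental.KZ.IntegralRep n),
      ∃ q : NumberTheory.Transcendental.KZ.IntegralRep (n + 2),
        (q.domain = {z : Fin (n + 2) → ℝ | z 0 ^ 2 + z 1 ^ 2 ≤ 1 ∧
            (fun i : Fin n => z i.succ.succ) ∈ r.domain} ∧
          q.integrand = fun z => r.integrand (fun i : Fin n => z i.succ.succ)) ∧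
        q.value = Real.pi * r.value := by
    intro n r
    let H : (Fin (n + 2) → ℝ) ≃ᵐ (ℝ × ℝ) × (Fin n → ℝ) :=
      ((MeasurableEquiv.piFinSuccAbove (fun _ : Fin (n + 2) => ℝ) 0).trans
        (MeasurableEquiv.prodCongr (MeasurableEquiv.refl ℝ)
          (MeasurableEquiv.piFinSuccAbove (fun _ : Fin (n + 1) => ℝ) 0))).trans
        MeasurableEquiv.prodAssoc.symm
    have hassoc : MeasurePreserving
        (MeasurableEquiv.prodAssoc : (ℝ × ℝ) × (Fin n → ℝ) ≃ᵐ ℝ × ℝ × (Fin n → ℝ)) volume volume :=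
      ⟨MeasurableEquiv.prodAssoc.measurable, Measure.prodAssoc_prod⟩
    have hH : MeasurePreserving H volume volume := by
      refine MeasurePreserving.trans ?_ hassoc.symm
      refine (volume_preserving_piFinSuccAbove (fun _ : Fin (n + 2) => ℝ) 0).trans ?_
      exact (MeasurePreserving.id volume).prod
        (volume_preserving_piFinSuccAbove (fun _ : Fin (n + 1) => ℝ) 0)
    have happ : ∀ z : Fin (n + 2) → ℝ, H z = ((z 0, z 1), fun i : Fin n => z i.succ.succ) :=
      fun z => rfl
    have hDeq : {z : Fin (n + 2) → ℝ | z 0 ^ 2 + z 1 ^ 2 ≤ 1 ∧ (fun i : Fin n => z i.succ.succ) ∈ r.domain} =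
        H ⁻¹' ({p : ℝ × ℝ | p.1 ^ 2 + p.2 ^ 2 ≤ 1} ×ˢ r.domain) := by
      ext z
      simp [happ]
    have hgeq : (fun z : Fin (n + 2) → ℝ => r.integrand (fun i : Fin n => z i.succ.succ)) =
        fun z => (fun q : (ℝ × ℝ) × (Fin n → ℝ) => (fun _ : ℝ × ℝ => (1 : ℝ)) q.1 * r.integrand q.2) (H z) := by
      funext z
      rw [happ]
      simp
    -- the domain `disc × σ` is ℚ-semialgebraic: a polynomial inequality meets a coordinate preimage
    have hD : ModelTheory.ExponentialFields.IsSemialgebraic ℚ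
        {z : Fin (n + 2) → ℝ | z 0 ^ 2 + z 1 ^ 2 ≤ 1 ∧ (fun i : Fin n => z i.succ.succ) ∈ r.domain} := by
      have h1 : ModelTheory.ExponentialFields.IsSemialgebraic ℚ
          {z : Fin (n + 2) → ℝ | z 0 ^ 2 + z 1 ^ 2 ≤ 1} := by
        have := ModelTheory.ExponentialFields.isSemialgebraic_setOf_eval_le
          (k := ℚ) (R := ℝ) (MvPolynomial.X 0 ^ 2 + MvPolynomial.X 1 ^ 2 : MvPolynomial (Fin (n + 2)) ℚ) 1
        simpa using this
      have h2 := r.isSemialgebraic_domain.preimage_comp (fun i : Fin n => i.succ.succ)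
      have hset : {z : Fin (n + 2) → ℝ | z 0 ^ 2 + z 1 ^ 2 ≤ 1 ∧ (fun i : Fin n => z i.succ.succ) ∈ r.domain} =
          {z : Fin (n + 2) → ℝ | z 0 ^ 2 + z 1 ^ 2 ≤ 1} ∩
            ((fun x : Fin (n + 2) → ℝ => x ∘ (fun i : Fin n => i.succ.succ)) ⁻¹' r.domain) := by
        ext z
        simp [Function.comp_def]
      rw [hset]
      exact h1.inter h2
    -- the integrand `f ∘ tail²` is ℚ-semialgebraic on it: coordinate preimage of the graph of `f`
    have hF : NumberTheory.Transcendental.IsSemialgebraicFunOn ℚ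
        {z : Fin (n + 2) → ℝ | z 0 ^ 2 + z 1 ^ 2 ≤ 1 ∧ (fun i : Fin n => z i.succ.succ) ∈ r.domain}
        (fun z => r.integrand (fun i : Fin n => z i.succ.succ)) := by
      rw [NumberTheory.Transcendental.isSemialgebraicFunOn_iff]
      let ρ : Fin (n + 1) → Fin (n + 2 + 1) :=
        Fin.lastCases (Fin.last (n + 2)) fun i => Fin.castSucc i.succ.succ
      have hΓ := (NumberTheory.Transcendental.isSemialgebraicFunOn_iff.mp
        r.isSemialgebraicFunOn_integrand).preimage_comp ρ
      convert hD.setOf_init_mem.inter hΓ using 1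
      have hinit : ∀ w : Fin (n + 2 + 1) → ℝ,
          Fin.init (w ∘ ρ) = fun i : Fin n => Fin.init w i.succ.succ := by
        intro w; ext i; simp [Fin.init, ρ]
      have hlast : ∀ w : Fin (n + 2 + 1) → ℝ, (w ∘ ρ) (Fin.last n) = w (Fin.last (n + 2)) := by
        intro w; simp [ρ]
      ext w
      simp only [mem_setOf_eq, mem_inter_iff, mem_preimage, hinit, hlast]
      tauto
    -- absolute convergence: Tonelli along `H`, `1 ⊗ f` on `disc × σ`
    have hI : IntegrableOn (fun z : Fin (n + 2) → ℝ => r.integrand (fun i : Fin n => z i.succ.succ))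
        {z : Fin (n + 2) → ℝ | z 0 ^ 2 + z 1 ^ 2 ≤ 1 ∧ (fun i : Fin n => z i.succ.succ) ∈ r.domain} := by
      have hc : IntegrableOn (fun _ : ℝ × ℝ => (1 : ℝ)) {p : ℝ × ℝ | p.1 ^ 2 + p.2 ^ 2 ≤ 1} :=
        integrableOn_const (by simp [hdisc])
      have hprod : IntegrableOn
          (fun p : (ℝ × ℝ) × (Fin n → ℝ) => (fun _ : ℝ × ℝ => (1 : ℝ)) p.1 * r.integrand p.2)
          ({p : ℝ × ℝ | p.1 ^ 2 + p.2 ^ 2 ≤ 1} ×ˢ r.domain) := by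
        rw [IntegrableOn, Measure.volume_eq_prod, ← Measure.prod_restrict]
        exact hc.mul_prod r.integrableOn
      rw [hDeq, hgeq]
      exact (hH.integrableOn_comp_preimage H.measurableEmbedding).mpr hprod
    -- the value law for `[disc × σ, f ∘ tail²]`
    have hv : ∫ z in {z : Fin (n + 2) → ℝ | z 0 ^ 2 + z 1 ^ 2 ≤ 1 ∧ (fun i : Fin n => z i.succ.succ) ∈ r.domain},
        r.integrand (fun i : Fin n => z i.succ.succ) = Real.pi * r.value := by
      rw [hDeq, hgeq]
      refine (hH.setIntegral_preimage_emb H.measurableEmbedding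
        (fun q : (ℝ × ℝ) × (Fin n → ℝ) => (fun _ : ℝ × ℝ => (1 : ℝ)) q.1 * r.integrand q.2) _).trans ?_
      rw [Measure.volume_eq_prod (ℝ × ℝ) (Fin n → ℝ),
        setIntegral_prod_mul (fun _ : ℝ × ℝ => (1 : ℝ)) r.integrand,
        NumberTheory.Transcendental.KZ.IntegralRep.value, setIntegral_const, smul_eq_mul, mul_one,
        measureReal_def, hdisc, ENNReal.toReal_ofReal Real.pi_pos.le]
    exact ⟨⟨_, _, hD, hF, hI⟩, ⟨rfl, rfl⟩, hv⟩
  choose P hPin hval using key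
  -- (2) the twist `T = lift (of ∘ P)` (multiplication by `[π]`) multiplies values by `π`
  have T_eval1 : ∀ c : NumberTheory.Transcendental.KZ.FormalRep,
      NumberTheory.Transcendental.KZ.eval
        ((FreeAbelianGroup.lift (fun s : (Σ n, NumberTheory.Transcendental.KZ.IntegralRep n) =>
          NumberTheory.Transcendental.KZ.of (P s.1 s.2))) c) =
        Real.pi * NumberTheory.Transcendental.KZ.eval c := by
    intro c
    induction c using FreeAbelianGroup.induction_on with
    | zero => simp
    | of y =>
      obtain ⟨k, s⟩ := y
      rw [FreeAbelianGroup.lift_apply_of]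
      change NumberTheory.Transcendental.KZ.eval (NumberTheory.Transcendental.KZ.of (P k s)) =
        Real.pi * NumberTheory.Transcendental.KZ.eval (NumberTheory.Transcendental.KZ.of s)
      rw [NumberTheory.Transcendental.KZ.eval_of, NumberTheory.Transcendental.KZ.eval_of, hval]
    | neg y ih => rw [map_neg, map_neg, ih, map_neg, mul_neg]
    | add y z ihy ihz => rw [map_add, map_add, ihy, ihz, map_add, mul_add]
  -- instantiate the cruxes at the padding; name the twist `T`
  have hS₀ := hS P hPin
  have hK₀ := hK P hPin
  have hP₀ := hP P hPin
  clear hS hK hP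
  generalize hTdef : (FreeAbelianGroup.lift (fun s : (Σ n, NumberTheory.Transcendental.KZ.IntegralRep n) =>
      NumberTheory.Transcendental.KZ.of (P s.1 s.2)) :
      NumberTheory.Transcendental.KZ.FormalRep →+ NumberTheory.Transcendental.KZ.FormalRep) = T
    at hS₀ hK₀ hP₀ T_eval1
  have T_sub : ∀ (k : ℕ) a b, (⇑T)^[k] (a - b) = (⇑T)^[k] a - (⇑T)^[k] b := by
    intro k
    induction k with
    | zero => intro a b; rfl
    | succ k ih =>
      intro a b
      rw [Function.iterate_succ_apply', Function.iterate_succ_apply', Function.iterate_succ_apply',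
        ih, map_sub]
  have T_eval : ∀ (k : ℕ) c, NumberTheory.Transcendental.KZ.eval ((⇑T)^[k] c) =
      Real.pi ^ k * NumberTheory.Transcendental.KZ.eval c := by
    intro k
    induction k with
    | zero => intro c; simp
    | succ k ih =>
      intro c
      rw [Function.iterate_succ_apply', T_eval1, ih, pow_succ]
      ring
  have T_peel : ∀ (k : ℕ) c, (⇑T)^[k] c ∈ NumberTheory.Transcendental.KZ.relations →
      c ∈ NumberTheory.Transcendental.KZ.relations := by
    intro k
    induction k with
    | zero => intro c h; simpa using h
    | succ k ih =>
      intro c h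
      rw [Function.iterate_succ_apply'] at h
      exact ih c (hP₀ _ h)
  -- (3) spin both representations with a common exponent
  intro n m r r' _ _ hv
  obtain ⟨N₁, h₁⟩ := hS₀ n r
  obtain ⟨N₂, h₂⟩ := hS₀ m r'
  obtain ⟨m₁, R₁, hR₁, e₁⟩ := h₁ (max N₁ N₂) (le_max_left _ _)
  obtain ⟨m₂, R₂, hR₂, e₂⟩ := h₂ (max N₁ N₂) (le_max_right _ _)
  set N := max N₁ N₂ with hN
  set c := NumberTheory.Transcendental.KZ.of r - NumberTheory.Transcendental.KZ.of r' with hc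
  set d := NumberTheory.Transcendental.KZ.of R₁ - NumberTheory.Transcendental.KZ.of R₂ with hd
  have hc0 : NumberTheory.Transcendental.KZ.eval c = 0 := by
    simp [hc, NumberTheory.Transcendental.KZ.eval_of, hv]
  -- `T^N c ≡ d` modulo relations, so `d` is a VANISHING combination of spherical representations
  have key : (⇑T)^[N] c - d ∈ NumberTheory.Transcendental.KZ.relations := by
    have : (⇑T)^[N] c - d = ((⇑T)^[N] (NumberTheory.Transcendental.KZ.of r) - NumberTheory.Transcendental.KZ.of R₁) -
        ((⇑T)^[N] (NumberTheory.Transcendental.KZ.of r') - NumberTheory.Transcendental.KZ.of R₂) := by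
      rw [hc, hd, T_sub]; abel
    rw [this]
    exact NumberTheory.Transcendental.KZ.relations.sub_mem e₁ e₂
  have hval0 : NumberTheory.Transcendental.KZ.eval d = 0 := by
    have h0 : NumberTheory.Transcendental.KZ.eval ((⇑T)^[N] c - d) = 0 :=
      NumberTheory.Transcendental.KZ.relations_le_ker_eval_holds key
    rw [map_sub, T_eval, hc0, mul_zero, zero_sub, neg_eq_zero] at h0
    exact h0
  -- (4) the core gives a `T`-power multiple of `d` in `relations`; π-cancellation peels it to
  -- `d ∈ relations`, hence `T^N c ∈ relations`, and π-cancellation peels again (no ideal property used)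
  obtain ⟨N', hN'⟩ := hK₀ d (AddSubgroup.sub_mem _ (AddSubgroup.subset_closure ⟨m₁, R₁, hR₁, rfl⟩)
    (AddSubgroup.subset_closure ⟨m₂, R₂, hR₂, rfl⟩)) hval0
  have hdrel : d ∈ NumberTheory.Transcendental.KZ.relations := T_peel N' _ hN'
  have hTN : (⇑T)^[N] c ∈ NumberTheory.Transcendental.KZ.relations := by
    simpa using NumberTheory.Transcendental.KZ.relations.add_mem key hdrel
  exact T_peel N _ hTN

end Summit.KontsevichZagierPeriods.KontsevichZagierPeriods.Theses.SpheresForWalls
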